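import Mathlib
import Summits.Ventures.PercRepro2.K5Kernel

/-!
# The `K₅` typed-positivity certificate of the (HCOV) kernel `K₃`: the tables and the numbers
(blind cell PercRepro2, typer-1 g10; lead g26 03:29:09Z «K5TypedK3» — p2's subtraction of the all-marked
`ResidualCore` instances, 03:22:27Z)

p1's eight-term kernel `K₃ x y w = f₂ x f₁ y f₄ w + f₁ x f₃ y f₅ w − f₂ x f₁ y f₆ w − f₂ x f₇ y f₈ w −
f₃ x f₇ y f₉ w + f₂ x f₇ y f₁₀ w − f₂ x f₁ y f₁₁ w + f₁ x f₁₂ y f₃ w` (`CovForm.K3`, `HCovCubic.lean`) is built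
from `f₁ = 1_Q`, `f₂ = 1_PD`, `f₃ = 1_PD 1_{o∈U}`, `f₄ = 1_Q σ_o σ_b`, `f₅ = 1_Q σ₃ σ_b`, `f₆ = 1_Q σ₃ 1_{o∈U} σ_b`,
`f₇ = 1_Q σ_b`, `f₈ = 1_Q σ_o`, `f₉ = 1_Q σ₃`, `f₁₀ = 1_Q σ₃ 1_{o∈U}`, `f₁₁ = 1_PD 1_{o∈U} 1_{b∈U}`, `f₁₂ = 1_PD 1_{b∈U}`
with `σ_v = 1_{v∈C₁} − 1_{v∈C₂}` and `1_{v∈U} = 1_{v∈C₁} + 1_{v∈C₂}`.  On `Q = {a₁ ↮ a₂}` the two clusters are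
disjoint, so every `f_i` is a difference `f_i⁺ − f_i⁻` of two `0/1` tables (`σ_u σ_v = 1_{same side} −
1_{opposite sides}`), and `K₃` expands into ten positive and ten negative products of three tables.

On `K₅` with the marks `o = 0, a₁ = 1, a₂ = 2, a₃ = 3` and `b` a parameter (`b = 4` distinct marks; `b = 3`
the coincidence `b = a₃`; `b = 0` the coincidence `o = b` — the three markings of p2's `MarksDistinct`),
the tables are Boolean functions of `ω : Fin 10 → Bool` through the bitmask connectivity `K5.conn` of
`K5Kernel.lean`, and `kPos3 b` / `kNeg3 b` are the Kronecker encodings of the positive / negative triple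
counts (base `KB = 2^20`; a digit is a sum of ten counts `≤ 3^10`, so `< 10 · 3^10 < 2^20`).

**The certificates** `cert3_4`, `cert3_3`, `cert3_0` (`K5K3Cert4.lean`, `K5K3Cert3.lean`, `K5K3Cert0.lean`,
one `decide +kernel` each): `kNeg3 b ≤ kPos3 b`, `Nat.land (kPos3 b − kNeg3 b) mask = 0`,
`Nat.land (kNeg3 b) mask = 0` — the digits of `kNeg3 b` are below `2^19` (mask), so are those of the
difference, hence no borrow: `kPos3 b ≥ kNeg3 b` DIGITWISE, i.e. every typed three-copy count of `K₃` on
`K₅` is `≥ 0` (`K5TypedK3.lean`).  Python twin: `k5k3_typer.py` (0 violations at all three markings,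
max digit 1453).
-/

namespace Summit.Ventures.PercRepro2

namespace K5

/-! ## The side tables -/

/-- `L_v = {v ∈ C₁}`: `v` joined to `a₁ = 1`. -/
def tL (v : ℕ) (ω : Fin 10 → Bool) : Bool := conn ω 1 v

/-- `H_v = {v ∈ C₂}`: `v` joined to `a₂ = 2`. -/
def tH (v : ℕ) (ω : Fin 10 → Bool) : Bool := conn ω 2 v

/-- `U_v = {v ∈ C₁ ∪ C₂}`. -/
def tU (v : ℕ) (ω : Fin 10 → Bool) : Bool := tL v ω || tH v ω

/-- `u` and `v` on the same side (both in `C₁` or both in `C₂`): the positive part of `σ_u σ_v`. -/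
def tSame (u v : ℕ) (ω : Fin 10 → Bool) : Bool := (tL u ω && tL v ω) || (tH u ω && tH v ω)

/-- `u` and `v` on opposite sides: the negative part of `σ_u σ_v`. -/
def tOpp (u v : ℕ) (ω : Fin 10 → Bool) : Bool := (tL u ω && tH v ω) || (tH u ω && tL v ω)

/-! ## The tables of the twelve functions (`f₁ = tQ`, `f₂ = tPD`, `f₃ = tPDoU`) -/

/-- `f₄⁺ = 1_Q 1_{o, b same side}`. -/
def t4p (b : ℕ) (ω : Fin 10 → Bool) : Bool := tQ ω && tSame 0 b ω
/-- `f₄⁻ = 1_Q 1_{o, b opposite}`. -/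
def t4m (b : ℕ) (ω : Fin 10 → Bool) : Bool := tQ ω && tOpp 0 b ω
/-- `f₅⁺ = 1_Q 1_{a₃, b same side}`. -/
def t5p (b : ℕ) (ω : Fin 10 → Bool) : Bool := tQ ω && tSame 3 b ω
/-- `f₅⁻ = 1_Q 1_{a₃, b opposite}`. -/
def t5m (b : ℕ) (ω : Fin 10 → Bool) : Bool := tQ ω && tOpp 3 b ω
/-- `f₆⁺ = 1_Q 1_{o∈U} 1_{a₃, b same side}`. -/
def t6p (b : ℕ) (ω : Fin 10 → Bool) : Bool := tQ ω && tU 0 ω && tSame 3 b ω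
/-- `f₆⁻ = 1_Q 1_{o∈U} 1_{a₃, b opposite}`. -/
def t6m (b : ℕ) (ω : Fin 10 → Bool) : Bool := tQ ω && tU 0 ω && tOpp 3 b ω
/-- `f₇⁺` at `v`: `1_Q 1_{v∈C₁}` (`f₇` at `b`, `f₈` at `o`, `f₉` at `a₃`). -/
def t7p (v : ℕ) (ω : Fin 10 → Bool) : Bool := tQ ω && tL v ω
/-- `f₇⁻` at `v`: `1_Q 1_{v∈C₂}`. -/
def t7m (v : ℕ) (ω : Fin 10 → Bool) : Bool := tQ ω && tH v ω
/-- `f₁₀⁺ = 1_Q 1_{a₃∈C₁} 1_{o∈U}`. -/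
def t10p (ω : Fin 10 → Bool) : Bool := tQ ω && tL 3 ω && tU 0 ω
/-- `f₁₀⁻ = 1_Q 1_{a₃∈C₂} 1_{o∈U}`. -/
def t10m (ω : Fin 10 → Bool) : Bool := tQ ω && tH 3 ω && tU 0 ω
/-- `f₁₁ = 1_PD 1_{o∈U} 1_{b∈U}`. -/
def t11 (b : ℕ) (ω : Fin 10 → Bool) : Bool := tPD ω && tU 0 ω && tU b ω
/-- `f₁₂ = 1_PD 1_{b∈U}`. -/
def t12 (b : ℕ) (ω : Fin 10 → Bool) : Bool := tPD ω && tU b ω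

/-! ## The Kronecker numbers -/

/-- The positive part of `K₃` on `K₅` (ten products, in the order `x, y, w` of the factors):
`f₂f₁f₄⁺ + f₁f₃f₅⁺ + f₂f₁f₆⁻ + f₂f₇⁺f₈⁻ + f₂f₇⁻f₈⁺ + f₃f₇⁺f₉⁻ + f₃f₇⁻f₉⁺ + f₂f₇⁺f₁₀⁺ + f₂f₇⁻f₁₀⁻ + f₁f₁₂f₃`. -/
def kPos3 (b : ℕ) : ℕ :=
  kron tPD * kron tQ * kron (t4p b) + kron tQ * kron tPDoU * kron (t5p b) +
    kron tPD * kron tQ * kron (t6m b) +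
    kron tPD * kron (t7p b) * kron (t7m 0) + kron tPD * kron (t7m b) * kron (t7p 0) +
    kron tPDoU * kron (t7p b) * kron (t7m 3) + kron tPDoU * kron (t7m b) * kron (t7p 3) +
    kron tPD * kron (t7p b) * kron t10p + kron tPD * kron (t7m b) * kron t10m +
    kron tQ * kron (t12 b) * kron tPDoU

/-- The negative part of `K₃` on `K₅` (ten products):
`f₂f₁f₄⁻ + f₁f₃f₅⁻ + f₂f₁f₆⁺ + f₂f₇⁺f₈⁺ + f₂f₇⁻f₈⁻ + f₃f₇⁺f₉⁺ + f₃f₇⁻f₉⁻ + f₂f₇⁺f₁₀⁻ + f₂f₇⁻f₁₀⁺ + f₂f₁f₁₁`. -/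
def kNeg3 (b : ℕ) : ℕ :=
  kron tPD * kron tQ * kron (t4m b) + kron tQ * kron tPDoU * kron (t5m b) +
    kron tPD * kron tQ * kron (t6p b) +
    kron tPD * kron (t7p b) * kron (t7p 0) + kron tPD * kron (t7m b) * kron (t7m 0) +
    kron tPDoU * kron (t7p b) * kron (t7p 3) + kron tPDoU * kron (t7m b) * kron (t7m 3) +
    kron tPD * kron (t7p b) * kron t10m + kron tPD * kron (t7m b) * kron t10p +
    kron tPD * kron tQ * kron (t11 b)

/-- **The certificate shape**: `kNeg3 b ≤ kPos3 b` and the two mask tests (no borrow anywhere, digits of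
`kNeg3 b` below `2^19`). -/
def Cert3 (b : ℕ) : Prop :=
  kNeg3 b ≤ kPos3 b ∧ Nat.land (kPos3 b - kNeg3 b) mask = 0 ∧ Nat.land (kNeg3 b) mask = 0

end K5

end Summit.Ventures.PercRepro2
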